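import Summits.Ventures.HSemireg.SecantParityObjectLevelSignedLaw
import Summits.Ventures.HSemireg.SecantParityObjectLevelDiagonalClasses
import HarnessLib

/-!
# Venture HSemireg — file IV's signed law is SHARP on `E_τ^{2m}` at EVERY `n = 2m`: its odd-index branch is inhabited
# iff `m` is even, its Riemann-form branch iff `m` is odd (witnesses: file V-b's diagonal classes `η_s`) — TRACK S4-PUSH (ii),
# seat `s4-prove-1` (g9 draft; g12 statement form + filing); file VII of the lane's object-level series

HONEST FRAMING. Lean index of the computation cell `pub-hsemireg`; object level in the sense of files III/IV/V-b (the power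
torus `E_τ^{2m} = E_{τ₀} × ⋯ × E_{τ_{2m-1}}` of the tree's Literature layer, `piPeriod`/`piForm`, `∫_X := ComplexTorus.torusIntegral`,
the intrinsic index `ComplexTorus.hermIndex`). No sheaf, secant plane, Ext group or semiregularity map is constructed; th-7 §D's
χ-identity «`(2w(-4d)ᵐ/(2m)!)·∫_X η^{∧2m} = G·(-2)`» enters BY VALUE exactly as in file IV (hypothesis `hHRR`, positive reals
`d, w, G`), and is supplied here by V-b's `chi_identity_signDiag` (`d = w = 1`, `G = 4ᵐ`); that a `K`-secant SHEAF realises it is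
the open existence clause (S4) and is NOT claimed. Nothing here says that HC, HC_CM or HC_AV holds; (S3)'s signed words
(«PROVED given `∫bⁿ > 0`», STRUCTURE.md v1.0 §2; STATUS WORD s4-ref P-2) do not move. NO definition, NO named fact: theorems only
(0 sorry), standard axioms. Imports files IV and V-b only.

WHAT IS ADDED TO THE LANE'S RECORD (sheet `s4push/prove-1/STATEMENTS-S3INPUT.md`, rows S3INP-8, S3INP-10; `ATTEMPT-10.md` §2 (2f),
`ATTEMPT-15.md` §1). File IV proved, for `η ∈ NS(X)` non-degenerate on a complex torus of dimension `n = 2m` satisfying the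
χ-identity: `Odd (m + hermIndex η)`; hence its two branches «`hermIndex η` odd ⇒ `m` even» and «`η` a Riemann form ⇒ `m` odd».
File V-b built, on `E_τ^g`, the classes `η_s = -(e₀ + ⋯ + e_{s-1}) + (e_s + ⋯ + e_{g-1}) ∈ NS` of every index `s ≤ g` and showed
that `η_s` satisfies the χ-identity whenever `m + s` is odd. Composed here, ON THE FIXED ABELIAN VARIETY `E_τ^{2m}` (any `τ ∈ 𝔥^{2m}`):
* `odd_add_hermIndex_signDiag` — IV's conclusion `Odd (m + hermIndex η_s)` holds for `η_s` (`s ≤ 2m`, `m + s` odd) with every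
  hypothesis of IV discharged by tree theorems (kernel composition IV ∘ V-b);
* `exists_odd_hermIndex_chi_identity_iff_even` — **SHARPNESS OF THE ODD BRANCH**: for `m > 0`, the hypothesis set of IV's
  `even_and_four_dvd_of_chi_identity_of_odd_hermIndex` («some `η ∈ NS(E_τ^{2m})`, non-degenerate, of ODD index, satisfies the
  χ-identity for some `d, w, G > 0`») is inhabited **iff `m` is even** (`⇒`: file IV; `⇐`: `η_{m+1}`, index `m + 1`);
* `exists_isRiemannForm_chi_identity_iff_odd` — **SHARPNESS OF THE RIEMANN-FORM BRANCH**: the hypothesis set of IV's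
  `IsRiemannForm.odd_and_not_four_dvd_of_chi_identity` («some polarisation of `E_τ^{2m}` satisfies the χ-identity for some
  `d, w, G > 0`») is inhabited **iff `m` is odd** (`⇒`: file IV; `⇐`: the product principal polarisation `⊞ E_{τ_k} = η₀`).
So at every even dimension exactly one of IV's two branches is numerically live on `E_τ^{2m}`: `n ≡ 0 (mod 4)` the odd-index
branch, `n ≡ 2 (mod 4)` the polarised one — the lane's reading «(S3)'s obstruction sits at `n ≡ 0 (mod 4)` for even index and at
`n ≡ 2 (mod 4)` for odd index» as two biconditionals about one abelian variety per dimension (so far by instances: file IV `n = 2`,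
file IVb/VI `n = 4`).

## References
* [Lange2023AbelianVarietiesComplex] H. Lange, Abelian Varieties over the Complex Numbers, Grundlehren Text Editions, Springer (2023),
  §1.7.1 Thm. 1.7.1, §1.7.2 Lemma 1.7.5 and proof of Thm. 1.7.3, §2.4.4 Thm. 2.4.25 — as cited in files IV and V-b.
* Cell records: `s4push/prove-1/ATTEMPT-10.md` §2 (2f), `ATTEMPT-15.md` §1; `STATEMENTS-S3INPUT.md` rows S3INP-5, -8, -10.
-/

noncomputable section

open scoped ComplexOrder
open Complex Module
open Literature.Geometry.Kaehler Literature.Geometry.Kaehler.ComplexTorus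

namespace Summit.Ventures.HSemireg

namespace SecantParity

variable {m : ℕ} {τ : Fin (2 * m) → ℂ} (hτ : ∀ k, 0 < (τ k).im)

/-- **IV's signed law fed by V-b at every `n = 2m`**: for `s ≤ 2m` with `m + s` odd, the class `η_s` on `E_τ^{2m}` satisfies every
hypothesis of `odd_add_hermIndex_of_chi_identity` (`η_s ∈ NS`, non-degenerate, `d = w = 1`, `G = 4ᵐ`, the χ-identity), whose conclusion
`Odd (m + hermIndex η_s)` the kernel confirms by composition. [cite: Lange2023AbelianVarietiesComplex, §1.7.2 Lemma 1.7.5 and proof of Thm. 1.7.3] -/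
theorem odd_add_hermIndex_signDiag {s : ℕ} (hs : s ≤ 2 * m) (hodd : Odd (m + s))
    (e : Fin (2 * (2 * m)) ≃ Fin (2 * m) × Fin 2) :
    Odd (m + hermIndex (piForm fun k : Fin (2 * m) ↦
      (((if (k : ℕ) < s then -1 else 1 : ℤ)) : ℝ) • ellipticForm (hτ k).ne')) :=
  odd_add_hermIndex_of_chi_identity _ (isNSForm_diag hτ _) (nondegenerate_signDiag hτ s) e one_pos one_pos
    (by positivity) (chi_identity_signDiag hτ hs hodd e)

/-- **SHARPNESS OF FILE IV's ODD BRANCH on `E_τ^{2m}` (`m > 0`).** The hypothesis set of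
`even_and_four_dvd_of_chi_identity_of_odd_hermIndex` — some `η ∈ NS(E_τ^{2m})`, non-degenerate, of ODD index `hermIndex η`, satisfying
th-7 §D's χ-identity `(2w(-4d)ᵐ/(2m)!)·∫_X η^{∧2m} = G·(-2)` for some reals `d, w, G > 0` — is inhabited **iff `m` is even**
(`n ≡ 0 (mod 4)`). `⇒` is file IV; `⇐` is V-b's `η_{m+1}` (index `m + 1`, odd; `d = w = 1`, `G = 4ᵐ`). No sheaf is asserted to exist.
[cite: Lange2023AbelianVarietiesComplex, §1.7.2 Lemma 1.7.5 and proof of Thm. 1.7.3] -/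
theorem exists_odd_hermIndex_chi_identity_iff_even (hm : 0 < m) (e : Fin (2 * (2 * m)) ≃ Fin (2 * m) × Fin 2) :
    (∃ (η : (Fin (2 * m) → ℂ) [⋀^Fin 2]→L[ℝ] ℝ) (d w G : ℝ),
        IsNSForm (piPeriod fun k : Fin (2 * m) ↦ ellipticPeriod (hτ k).ne') η ∧
        (∀ v : Fin (2 * m) → ℂ, v ≠ 0 → ∃ u : Fin (2 * m) → ℂ, η ![v, u] ≠ 0) ∧ Odd (hermIndex η) ∧
        0 < d ∧ 0 < w ∧ 0 < G ∧
        (2 * (w : ℂ) * (-4 * (d : ℂ)) ^ m / ((2 * m).factorial : ℂ)) *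
            torusIntegral (piPeriod fun k : Fin (2 * m) ↦ ellipticPeriod (hτ k).ne') e (wedgePow (ofRealForm η) (2 * m)) =
          (G : ℂ) * (-2)) ↔ Even m := by
  constructor
  · rintro ⟨η, d, w, G, hη, hnd, hs, hd, hw, hG, hHRR⟩
    exact (even_and_four_dvd_of_chi_identity_of_odd_hermIndex _ hη hnd e hd hw hG hHRR hs).1
  · intro hme
    refine ⟨_, 1, 1, 4 ^ m, isNSForm_diag hτ _, nondegenerate_signDiag hτ (m + 1), ?_, one_pos, one_pos, by positivity, ?_⟩
    · rw [hermIndex_signDiag hτ (by omega)]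
      exact hme.add_one
    · exact_mod_cast chi_identity_signDiag_succ hτ hm e

/-- **SHARPNESS OF FILE IV's RIEMANN-FORM BRANCH on `E_τ^{2m}`.** The hypothesis set of
`IsRiemannForm.odd_and_not_four_dvd_of_chi_identity` — some polarisation `η` of `E_τ^{2m}` (Riemann form, Lange's definition) satisfying
the χ-identity for some reals `d, w, G > 0` — is inhabited **iff `m` is odd** (`n ≡ 2 (mod 4)`). `⇒` is file IV; `⇐` is the product
principal polarisation `⊞_k E_{τ_k}` (V-b's `η₀`; `d = w = 1`, `G = 4ᵐ`). No sheaf is asserted to exist.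
[cite: Lange2023AbelianVarietiesComplex, §1.7.1 Thm. 1.7.1 and §1.7.2 Thm. 1.7.3] -/
theorem exists_isRiemannForm_chi_identity_iff_odd (e : Fin (2 * (2 * m)) ≃ Fin (2 * m) × Fin 2) :
    (∃ (η : (Fin (2 * m) → ℂ) [⋀^Fin 2]→L[ℝ] ℝ) (d w G : ℝ),
        IsRiemannForm (piPeriod fun k : Fin (2 * m) ↦ ellipticPeriod (hτ k).ne') η ∧ 0 < d ∧ 0 < w ∧ 0 < G ∧
        (2 * (w : ℂ) * (-4 * (d : ℂ)) ^ m / ((2 * m).factorial : ℂ)) *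
            torusIntegral (piPeriod fun k : Fin (2 * m) ↦ ellipticPeriod (hτ k).ne') e (wedgePow (ofRealForm η) (2 * m)) =
          (G : ℂ) * (-2)) ↔ Odd m := by
  constructor
  · rintro ⟨η, d, w, G, hη, hd, hw, hG, hHRR⟩
    exact (IsRiemannForm.odd_and_not_four_dvd_of_chi_identity _ hη e hd hw hG hHRR).1
  · intro hmo
    refine ⟨piForm fun k : Fin (2 * m) ↦ ellipticForm (hτ k).ne', 1, 1, 4 ^ m,
      IsRiemannForm.pi fun k ↦ isRiemannForm_ellipticForm (hτ k), one_pos, one_pos, by positivity, ?_⟩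
    have h := chi_identity_signDiag hτ (Nat.zero_le _) (by simpa using hmo) e
    simpa using h

end SecantParity

end Summit.Ventures.HSemireg
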